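import Literature.IUT.HodgeArakelov.MonoThetaCyclotomes

/-!
# [IUTchII] §1, Def. 1.1: functoriality of the Definition 1.1 output — transport along isomorphisms of
# mono-theta environments

abc-iut cell, MERGE-MAP §8 **B8** (part 4; abc-iut-L6-d6). `Literature.IUT.HodgeArakelov.MonoThetaCyclotomes`
(abc-iut-L6-t1, p405104) types the OUTPUT of the "functorial group-theoretic algorithms" of [IUTchII]
Definition 1.1 (i), (ii) (kurims pp. 20–21) as the structures `Reconstruction M`, `CyclotomicRigidity R`,
`Def11Output M` over a mono-theta environment `M : MonoThetaEnv S`, and records (module doc, "Existence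
clauses"): "functoriality = transport of `Def11Output` along `MonoThetaEnv.Iso` (routine; to be added as a
proved definition at merge)". This file supplies exactly that, and draws the consequence the printed word
"functorial" carries in the cell's typing:

* `MonoThetaEnv.Iso.refl/symm/trans` and `MonoThetaEnv.nonempty_iso`: ANY two mono-theta environments of the
  same setting `S` are isomorphic (both are isomorphic to the reference model — field `isModel`);
* `Reconstruction.transport`, `CyclotomicRigidity.transport`, `Def11Output.transport`: the Def. 1.1 output
  of `M` transported along `α : MonoThetaEnv.Iso M M'` is a Def. 1.1 output of `M'` (the reconstructed groups
  `Π_Y, Π_X, G`, the interior cyclotome and all actions are KEPT; only the structure maps from `Π_{M'}` are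
  precomposed with `α⁻¹`, and the exterior cyclotome `Π_μ = Ker(Π_M ↠ Π_Y)` is carried along `α`);
* `Def11Output.ofAny`: hence a Def. 1.1 output for ONE mono-theta environment of `S` (e.g. the [EtTh] model,
  owner abc-iut-L2-t2 via bridge B8 parts 1–3) yields one for EVERY mono-theta environment of `S`.

Pure bookkeeping over t1's interface; nothing disputed is asserted and no side is taken on [IUTchIII]
Cor. 3.12; typed ≠ discharged. Source of the shape: [IUTchII] §1 Def. 1.1 [claim: Mochizuki2012, status:
disputed] (IUTchII §1 Def 1.1, kurims pp.20-21); [cite: MochizukiEtTh2009, Def 2.13(ii) p.48] (isomorphisms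
of mono-theta environments).
-/

namespace Literature.IUT.HodgeArakelov

universe u

variable {S : ThetaSetting.{u}}

/-! ## Isomorphisms of mono-theta environments: groupoid structure, and connectedness of the setting -/

namespace MonoThetaEnv

/-- Transport of subgroups of `Aut` along `MulAut.congr` is functorial: composite.
[cite: MochizukiEtTh2009, Def 2.13(ii) p.48] -/
theorem congr_trans_toMonoidHom {A B C : Type u} [Group A] [Group B] [Group C] (e : A ≃* B) (f : B ≃* C) :
    (MulAut.congr (e.trans f)).toMonoidHom =
      (MulAut.congr f).toMonoidHom.comp (MulAut.congr e).toMonoidHom := by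
  ext φ x
  rfl

/-- A subgroup mapped forth along `e` and back along `e⁻¹` returns to itself.
[cite: MochizukiEtTh2009, Def 2.13(ii) p.48] -/
theorem map_symm_map {A B : Type u} [Group A] [Group B] [TopologicalSpace A] [TopologicalSpace B]
    (e : A ≃ₜ* B) (H : Subgroup A) :
    (H.map e.toMulEquiv.toMonoidHom).map e.symm.toMulEquiv.toMonoidHom = H := by
  rw [Subgroup.map_map]
  convert Subgroup.map_id H
  ext x
  change e.symm (e x) = x
  simp

/-- A set of subgroups mapped forth along `e` and back along `e⁻¹` returns to itself.
[cite: MochizukiEtTh2009, Def 2.13(ii) p.48] -/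
theorem image_map_symm_image_map {A B : Type u} [Group A] [Group B] [TopologicalSpace A]
    [TopologicalSpace B] (e : A ≃ₜ* B) (T : Set (Subgroup A)) :
    (fun H : Subgroup B => H.map e.symm.toMulEquiv.toMonoidHom) ''
        ((fun H : Subgroup A => H.map e.toMulEquiv.toMonoidHom) '' T) = T := by
  rw [Set.image_image]
  exact (Set.image_congr fun H _ => map_symm_map e H).trans (Set.image_id' T)

/-- Kernels precomposed with `e⁻¹` are images under `e`. [cite: MochizukiEtTh2009, Def 2.13(ii) p.48] -/
theorem ker_comp_symm_eq_map {A B X : Type u} [Group A] [Group B] [Group X] [TopologicalSpace A]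
    [TopologicalSpace B] (f : A →* X) (e : A ≃ₜ* B) :
    (f.comp e.symm.toMulEquiv.toMonoidHom).ker = f.ker.map e.toMulEquiv.toMonoidHom := by
  ext y
  constructor
  · intro hy
    exact Subgroup.mem_map.2 ⟨e.symm y, hy, e.apply_symm_apply y⟩
  · intro hy
    obtain ⟨x, hx, rfl⟩ := Subgroup.mem_map.1 hy
    change f (e.symm (e x)) = 1
    rw [ContinuousMulEquiv.symm_apply_apply]
    exact hx

/-- The identity isomorphism of a mono-theta environment. [cite: MochizukiEtTh2009, Def 2.13(ii) p.48] -/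
def Iso.refl (M : MonoThetaEnv S) : MonoThetaEnv.Iso M M where
  iso := ContinuousMulEquiv.refl M.Pi
  map_D := by
    convert Subgroup.map_id M.D
    ext φ x
    rfl
  map_theta := by
    have h : (fun H : Subgroup M.Pi => H.map (ContinuousMulEquiv.refl M.Pi).toMulEquiv.toMonoidHom) = id := by
      funext H
      exact Subgroup.map_id H
    rw [h, Set.image_id]

/-- The inverse of an isomorphism of mono-theta environments. [cite: MochizukiEtTh2009, Def 2.13(ii) p.48] -/
def Iso.symm {M M' : MonoThetaEnv S} (α : MonoThetaEnv.Iso M M') : MonoThetaEnv.Iso M' M where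
  iso := α.iso.symm
  map_D := by
    rw [← α.map_D, Subgroup.map_map]
    convert Subgroup.map_id M.D
    ext φ x
    change α.iso.symm (α.iso (φ (α.iso.symm (α.iso x)))) = φ x
    simp
  map_theta := by
    rw [← α.map_theta]
    exact image_map_symm_image_map α.iso M.theta

/-- The composite of two isomorphisms of mono-theta environments. [cite: MochizukiEtTh2009, Def 2.13(ii) p.48] -/
def Iso.trans {M M' M'' : MonoThetaEnv S} (α : MonoThetaEnv.Iso M M') (β : MonoThetaEnv.Iso M' M'') :
    MonoThetaEnv.Iso M M'' where
  iso := α.iso.trans β.iso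
  map_D := by
    rw [← β.map_D, ← α.map_D, Subgroup.map_map]
    rfl
  map_theta := by
    rw [← β.map_theta, ← α.map_theta, Set.image_image]
    congr 1
    funext H
    rw [Subgroup.map_map]
    rfl

/-- **Any two mono-theta environments of the same [IUTchII] §1 setting are isomorphic** (each is, by its field
`isModel`, isomorphic to "the mod `N` model mono-theta environment determined by `X̲̲_k`", p. 20).
[claim: Mochizuki2012, status: disputed] (IUTchII §1 Def 1.1, kurims p.20) -/
theorem nonempty_iso (M M' : MonoThetaEnv S) : Nonempty (MonoThetaEnv.Iso M M') := by
  obtain ⟨e, hD, hθ⟩ := M.isModel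
  obtain ⟨e', hD', hθ'⟩ := M'.isModel
  refine ⟨{ iso := e.trans e'.symm, map_D := ?_, map_theta := ?_ }⟩
  · have h1 : (MulAut.congr (e.trans e'.symm).toMulEquiv).toMonoidHom =
        (MulAut.congr e'.symm.toMulEquiv).toMonoidHom.comp (MulAut.congr e.toMulEquiv).toMonoidHom := by
      ext φ x
      rfl
    rw [h1, ← Subgroup.map_map, hD, ← hD', Subgroup.map_map]
    convert Subgroup.map_id M'.D
    ext φ x
    change e'.symm (e' (φ (e'.symm (e' x)))) = φ x
    simp
  · have h1 : (fun H : Subgroup M.Pi => H.map (e.trans e'.symm).toMulEquiv.toMonoidHom) =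
        (fun H : Subgroup S.modelPi => H.map e'.symm.toMulEquiv.toMonoidHom) ∘
          fun H : Subgroup M.Pi => H.map e.toMulEquiv.toMonoidHom := by
      funext H
      change H.map _ = (H.map _).map _
      rw [Subgroup.map_map]
      rfl
    rw [h1, Set.image_comp, hθ, ← hθ']
    exact image_map_symm_image_map e' M'.theta

end MonoThetaEnv

/-! ## Transport of the Definition 1.1 (i) output -/

namespace Reconstruction

variable {M M' : MonoThetaEnv S}

/-- The kernel of `Π_M ↠ Π_Y(M)` precomposed with `α⁻¹ : Π_{M'} ≅ Π_M` is the image of `Π_μ(M)` under `α`.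
[claim: Mochizuki2012, status: disputed] (IUTchII §1 Def 1.1 (i), kurims p.21) -/
theorem ker_comp_symm_eq_map (R : Reconstruction M) (α : MonoThetaEnv.Iso M M') :
    (R.projY.comp α.iso.symm.toMulEquiv.toMonoidHom).ker = R.extCyc.map α.iso.toMulEquiv.toMonoidHom :=
  MonoThetaEnv.ker_comp_symm_eq_map R.projY α.iso

/-- `α` restricted to the exterior cyclotomes: `Π_μ(M) ≅ Ker(Π_{M'} → Π_M ↠ Π_Y(M))`.
[claim: Mochizuki2012, status: disputed] (IUTchII §1 Def 1.1 (i), kurims p.21) -/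
def extCycEquiv (R : Reconstruction M) (α : MonoThetaEnv.Iso M M') :
    R.extCyc ≃* (R.projY.comp α.iso.symm.toMulEquiv.toMonoidHom).ker :=
  (α.iso.toMulEquiv.subgroupMap R.extCyc).trans (MulEquiv.subgroupCongr (R.ker_comp_symm_eq_map α).symm)

/-- The underlying map of `extCycEquiv` is `α`. [claim: Mochizuki2012, status: disputed] (IUTchII §1 Def 1.1 (i), kurims p.21) -/
@[simp] theorem coe_extCycEquiv (R : Reconstruction M) (α : MonoThetaEnv.Iso M M') (x : R.extCyc) :
    ((R.extCycEquiv α x : (R.projY.comp α.iso.symm.toMulEquiv.toMonoidHom).ker) : M'.Pi) = α.iso x := rfl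

/-- The underlying map of `extCycEquiv.symm` is `α⁻¹`. [claim: Mochizuki2012, status: disputed] (IUTchII §1 Def 1.1 (i), kurims p.21) -/
theorem coe_extCycEquiv_symm (R : Reconstruction M) (α : MonoThetaEnv.Iso M M')
    (y : (R.projY.comp α.iso.symm.toMulEquiv.toMonoidHom).ker) :
    (((R.extCycEquiv α).symm y : R.extCyc) : M.Pi) = α.iso.symm y := by
  have h := R.coe_extCycEquiv α ((R.extCycEquiv α).symm y)
  rw [MulEquiv.apply_symm_apply] at h
  rw [h, ContinuousMulEquiv.symm_apply_apply]

/-- **Functoriality of [IUTchII] Def. 1.1 (i)**: the output `(Π_Y, Π_X, G, (l·Δ_Θ), Π_μ, actions)` of `M`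
transported along an isomorphism `α : M ≅ M'` of mono-theta environments is a Def. 1.1 (i) output of `M'`:
the reconstructed groups and the interior cyclotome with its action are kept, `Π_{M'} ↠ Π_Y` is
`Π_{M'} →α⁻¹→ Π_M ↠ Π_Y(M)`, and the exterior cyclotome with its `Π_X`-action is carried along `α`.
[claim: Mochizuki2012, status: disputed] (IUTchII §1 Def 1.1 (i), kurims pp.20-21) -/
noncomputable def transport (R : Reconstruction M) (α : MonoThetaEnv.Iso M M') : Reconstruction M' where
  PiY := R.PiY
  projY := R.projY.comp α.iso.symm.toMulEquiv.toMonoidHom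
  projY_continuous := R.projY_continuous.comp α.iso.symm.continuous
  projY_surjective := R.projY_surjective.comp α.iso.symm.surjective
  projY_quotientMap := R.projY_quotientMap.comp α.iso.symm.toHomeomorph.isQuotientMap
  isClosed_ker_projY := by
    have h : (((R.projY.comp α.iso.symm.toMulEquiv.toMonoidHom).ker : Subgroup M'.Pi) : Set M'.Pi) =
        α.iso.symm ⁻¹' (R.projY.ker : Set M.Pi) := rfl
    rw [h]
    exact R.isClosed_ker_projY.preimage α.iso.symm.continuous
  PiX := R.PiX
  inclY := R.inclY
  inclY_isOpenEmbedding := R.inclY_isOpenEmbedding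
  inclY_normal := R.inclY_normal
  G := R.G
  projG := R.projG
  projG_continuous := R.projG_continuous
  projG_surjective := R.projG_surjective
  projG_quotientMap := R.projG_quotientMap
  isClosed_ker_projG := R.isClosed_ker_projG
  projG_corresponds := R.projG_corresponds
  intCyc := R.intCyc
  intAct := R.intAct
  int_iso_ZHat := R.int_iso_ZHat
  extAct := (MulAut.congr (R.extCycEquiv α)).toMonoidHom.comp R.extAct
  ext_iso_ZMod := ⟨(R.extCycEquiv α).symm.trans R.ext_iso_ZMod.some⟩
  projG_inclY_surjective := R.projG_inclY_surjective
  outer_action_lifts := by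
    intro x
    obtain ⟨φ, hφ⟩ := R.outer_action_lifts x
    -- `Δ_{M'} = α(Δ_M)`: carry `φ` along `α`
    have hker : (R.projG.comp (R.inclY.comp (R.projY.comp α.iso.symm.toMulEquiv.toMonoidHom))).ker =
        (R.projG.comp (R.inclY.comp R.projY)).ker.map α.iso.toMulEquiv.toMonoidHom :=
      MonoThetaEnv.ker_comp_symm_eq_map (R.projG.comp (R.inclY.comp R.projY)) α.iso
    let ε : (R.projG.comp (R.inclY.comp R.projY)).ker ≃*
        (R.projG.comp (R.inclY.comp (R.projY.comp α.iso.symm.toMulEquiv.toMonoidHom))).ker :=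
      (α.iso.toMulEquiv.subgroupMap _).trans (MulEquiv.subgroupCongr hker.symm)
    have hε : ∀ δ, ((ε.symm δ : (R.projG.comp (R.inclY.comp R.projY)).ker) : M.Pi) = α.iso.symm δ := by
      intro δ
      have h1 : ((ε (ε.symm δ) : _) : M'.Pi) = α.iso (ε.symm δ : M.Pi) := rfl
      rw [MulEquiv.apply_symm_apply] at h1
      rw [← α.iso.symm_apply_apply (ε.symm δ : M.Pi), ← h1]
    refine ⟨MulAut.congr ε φ, fun δ => ?_⟩
    have h2 : ((MulAut.congr ε φ δ : _) : M'.Pi) = α.iso (φ (ε.symm δ) : M.Pi) := rfl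
    change R.inclY (R.projY (α.iso.symm (MulAut.congr ε φ δ : M'.Pi))) =
      x * R.inclY (R.projY (α.iso.symm (δ : M'.Pi))) * x⁻¹
    rw [h2, ContinuousMulEquiv.symm_apply_apply, hφ (ε.symm δ), hε]

/-- The reconstructed `Π_X` is unchanged by transport. [claim: Mochizuki2012, status: disputed] (IUTchII §1 Def 1.1 (i), kurims p.21) -/
@[simp] theorem transport_PiX (R : Reconstruction M) (α : MonoThetaEnv.Iso M M') : (R.transport α).PiX = R.PiX :=
  rfl

/-- The interior cyclotome is unchanged by transport. [claim: Mochizuki2012, status: disputed] (IUTchII §1 Def 1.1 (i), kurims p.21) -/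
@[simp] theorem transport_intCyc (R : Reconstruction M) (α : MonoThetaEnv.Iso M M') :
    (R.transport α).intCyc = R.intCyc := rfl

/-- The exterior cyclotome of the transported output is `α(Π_μ(M))`.
[claim: Mochizuki2012, status: disputed] (IUTchII §1 Def 1.1 (i), kurims p.21) -/
theorem transport_extCyc (R : Reconstruction M) (α : MonoThetaEnv.Iso M M') :
    (R.transport α).extCyc = R.extCyc.map α.iso.toMulEquiv.toMonoidHom :=
  R.ker_comp_symm_eq_map α

/-- The transported exterior action is the original one conjugated by `α|_{Π_μ}`.
[claim: Mochizuki2012, status: disputed] (IUTchII §1 Def 1.1 (i), kurims p.21) -/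
theorem transport_extAct_apply (R : Reconstruction M) (α : MonoThetaEnv.Iso M M') (x : R.PiX)
    (y : (R.transport α).extCyc) :
    (R.transport α).extAct x y = R.extCycEquiv α (R.extAct x ((R.extCycEquiv α).symm y)) := rfl

end Reconstruction

/-! ## Transport of the Definition 1.1 (ii) output and of the bundled output -/

namespace CyclotomicRigidity

variable {M M' : MonoThetaEnv S} {R : Reconstruction M}

/-- **Functoriality of [IUTchII] Def. 1.1 (ii)**: the cyclotomic rigidity isomorphism
`(l·Δ_Θ)(M) ⊗ ℤ/Nℤ ≅ Π_μ(M)` composed with `α|_{Π_μ}` is a cyclotomic rigidity isomorphism for the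
transported Def. 1.1 (i) output (equivariance is preserved because the exterior action was conjugated by the
same `α|_{Π_μ}`). [claim: Mochizuki2012, status: disputed] (IUTchII §1 Def 1.1 (ii), kurims p.21) -/
noncomputable def transport (C : CyclotomicRigidity R) (α : MonoThetaEnv.Iso M M') :
    CyclotomicRigidity (R.transport α) where
  iso := C.iso.trans (R.extCycEquiv α)
  equivariant x c := by
    change R.extCycEquiv α (C.iso (QuotientGroup.mk (R.intAct x c))) =
      R.extCycEquiv α (R.extAct x ((R.extCycEquiv α).symm (R.extCycEquiv α (C.iso (QuotientGroup.mk c)))))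
    rw [MulEquiv.symm_apply_apply, C.equivariant]

/-- The transported rigidity isomorphism, on elements. [claim: Mochizuki2012, status: disputed] (IUTchII §1 Def 1.1 (ii), kurims p.21) -/
theorem transport_iso_apply (C : CyclotomicRigidity R) (α : MonoThetaEnv.Iso M M')
    (c : ModPow R.intCyc.carrier (S.N : ℕ)) :
    (((C.transport α).iso c : (R.transport α).extCyc) : M'.Pi) = α.iso (C.iso c : M.Pi) := rfl

end CyclotomicRigidity

namespace Def11Output

variable {M M' : MonoThetaEnv S}

/-- **Functoriality of the bundled Def. 1.1 output** along isomorphisms of mono-theta environments.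
[claim: Mochizuki2012, status: disputed] (IUTchII §1 Def 1.1, kurims pp.20-21) -/
noncomputable def transport (O : Def11Output M) (α : MonoThetaEnv.Iso M M') : Def11Output M' where
  recon := O.recon.transport α
  rigidity := O.rigidity.transport α

/-- **"Functorial algorithm"**: a Def. 1.1 output for ONE mono-theta environment of the setting `S` yields one
for EVERY mono-theta environment of `S` (transport along the isomorphism of `MonoThetaEnv.nonempty_iso`). In
particular the EXISTENCE content of Def. 1.1 for the whole setting reduces to the [EtTh] construction for the
model ([EtTh] Cor. 2.18, 2.19; owner abc-iut-L2-t2; bridge B8 parts 1–3 identify the model).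
[claim: Mochizuki2012, status: disputed] (IUTchII §1 Def 1.1, kurims pp.20-21) -/
noncomputable def ofAny (O : Def11Output M) (M' : MonoThetaEnv S) : Def11Output M' :=
  O.transport (MonoThetaEnv.nonempty_iso M M').some

/-- Existence form: `Def11Output` is inhabited for all mono-theta environments of `S` as soon as it is for one.
[claim: Mochizuki2012, status: disputed] (IUTchII §1 Def 1.1, kurims pp.20-21) -/
theorem nonempty_forall_of_nonempty (h : Nonempty (Def11Output M)) (M' : MonoThetaEnv S) :
    Nonempty (Def11Output M') :=
  ⟨h.some.ofAny M'⟩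

end Def11Output

end Literature.IUT.HodgeArakelov
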